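/-
Copyright (c) 2026 the pub-hodgecm-mathlib formalisation cell (harness21).  Prover seat hodgecm-mathlib-LH4-p09 (g10) (VALVE hand; K1b desk K2Liu-p14 (g5) DESK WORD #9 (2):
writer of the ONE-FRAME ASSEMBLY), Track B «K2-LIT» ∕ hLiu418 socket #41 KIND 1, package (K1b-♮), letter (P-dec): PRELIMINARIES OF THE ONE-FRAME ASSEMBLY — the per-place
factor of the block letter against ONE ceiling, the polynomial into the Gaussian, the re-indexing of the place sum.  THEOREMS ONLY.
-/
import Summits.HodgeConjecture.HodgeConjecture.Theorems.K2LiuKindOneLineCornerBlockFaces        -- ★ p864074 (dec-3c) (+ ★ (dec-3b-ii) p863856∕p863979, ★ G7, ★ G7-B)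
import Summits.HodgeConjecture.HodgeConjecture.Theorems.K2LiuSiegelEisensteinKindWLocalExponents -- ★ `one_add_pow_mul_exp_neg_le` (absorption)
import HarnessLib

/-!
# Crux `HLiu418`, socket #41, KIND 1 — (P-dec) `K2LiuKindOneLineDecayOneFramePrelims`: PRELIMINARIES OF THE ONE-FRAME ASSEMBLY

Cell `hodgecm-mathlib`, crux item hLiu418 = `stmt-HodgeConjecture-24832` (helper lane `--supports … --as helper`, count-neutral), route of record `HCCMUnconditional`;
squad K2 ∕ K2Liu; K1b desk K2Liu-p14 (g5) DESK WORD #9 (2) (2026-09-05T01:08:56Z): the ONE-FRAME ASSEMBLY `K2LiuKindOneLineDecayOneFrame :: hdecF₀_of_blockLetter`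
(producer of ★ LH4-p14 (g8) `K2LiuKindOneLineDecay.wdec_of_oneFrame`'s letter `hdecF₀` from ONE block letter `hBL₁` on `h`; SIG v0 K2 bus 2026-09-05T01:17:14Z, DESIGN v1
01:19:01Z).  THEOREMS ONLY (no `def`, no `instance`, no notation, no named-fact hypothesis, no `sorry`).

THE POINT.  The assembly bounds, per `z`, the block letter's right-hand side
`C·‖h‖^a·D^{a₂}·(1+τS)^{N₀} · ∏_σ ρ_σ^{e₁(s)} · ‖det Y_σ‖^{e₂(s)} · (1 + |σ♭|_σ ρ_σ)^{Ng} · e^{−π |σ♭|_σ ρ_σ}` (`Y_σ = ĝ^{φ_σ}·A_σ`, `ρ_σ = Σ_k ‖(Y_σ)_{1k}‖²`) by the TOP's shape.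
THIS FILE is its place-by-place arithmetic, isolated from the adelic vocabulary:
* **`perPlace_le`** — the per-place factor against ONE ceiling `a₁ ≥ 8·Vb²·R²` (`Vb` bounds the entries of `ĝ^{φ}, (ĝ⁻¹)^{φ}`, `R = c_B‖h‖` those of `A_σ, A_σ⁻¹`):
  `ρ^{e₁}·‖det Y‖^{e₂}·((1+mρ)^{Ng}·e^{−π mρ}) ≤ a₁^{κ₁}·a₁^{κ₂}·(K(Ng)·e^{−(π∕2) mρ})` for `|e₁| ≤ κ₁`, `|e₂| ≤ κ₂`, `m ≥ 0`;
* `one_add_rpow_mul_exp_neg_pi_le` — the polynomial into the Gaussian at rate `π∕2`;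
* `sum_comp_le_sum_of_injective` — the re-indexing `Σ_{v ∣ ∞} g(σ(v)) ≤ Σ_σ g(σ)` of the Gaussian's place sum along a section `σ(·)` of the frames' cover
  (★ (ρ4-𝔸) sums over `InfinitePlace L`, the frames of record over `Sinf`).
WHAT REMAINS for `hdecF₀_of_blockLetter` (statement generated from cand 68100908's `hdecF₀` bytes — HOME `F0/P3c/LH4/LH4-p09/g10/oneframe/`): instantiate ★ p862643
(`D₀, σ♭`), ★ p862843 (block decomposition of `h`), ★ G7-B (`R = c_B‖h‖`), the entry bound `Vb = 1 + τS·D^{d+1}(1+τS)^d` (★ `KindWDecay.inv_apply_det_le` at `n := 1`),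
★ (ρ4-𝔸) p863568 for `e^{−(π∕2)Σ}` and ★ `one_add_pow_mul_exp_neg_le` for the final `(1+τS)`-absorption (`Nb := 0`).
HONEST LABEL.  Count-neutral helper; closes no socket: `HC_CM` is proved only modulo the 7 printed citations (2 remaining named inputs: hLiu418 = `stmt-HodgeConjecture-24832`,
h413 = `stmt-HodgeConjecture-24833`) until rung 0 closes.
-/

set_option autoImplicit false
set_option linter.dupNamespace false -- the mandated namespace repeats `HodgeConjecture.HodgeConjecture`

noncomputable section

open scoped Matrix BigOperators ComplexConjugate

namespace Summit.HodgeConjecture.HodgeConjecture.Cruxes.HLiu418.K2LiuKindOneLineDecayOneFramePrelims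

open Summit.HodgeConjecture.HodgeConjecture.Cruxes.HLiu418.K2LiuKindOneLineCornerBlockFaces (corner_row_sq_eq norm_det_rpow_le)
open Summit.HodgeConjecture.HodgeConjecture.Cruxes.HLiu418.K2LiuKindOneLineDecayLowerPowerFace
  (rpow_le_rpow_abs rpow_le_rpow_of_abs_le one_le_of_le_of_inv_le inv_sum_sq_vecMul_le sum_sq_vecMul_pos)
open Summit.HodgeConjecture.HodgeConjecture.Cruxes.HLiu418.K2LiuSiegelEisensteinKindWLocalExponents (one_add_pow_mul_exp_neg_le)
open Summit.HodgeConjecture.HodgeConjecture.Cruxes.HLiu418.K2LiuArchBlockHeightBound (norm_mul_apply_le)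

/-- an injective re-indexing of a sum of non-negative terms is below the full sum. [folklore] -/
theorem sum_comp_le_sum_of_injective {V S : Type*} [Fintype V] [Fintype S] (σv : V → S) (hinj : Function.Injective σv)
    (g : S → ℝ) (hg : ∀ σ, 0 ≤ g σ) : ∑ v, g (σv v) ≤ ∑ σ, g σ := by
  classical
  rw [← Finset.sum_image (f := g) (s := Finset.univ) (g := σv) fun x _ y _ h => hinj h]
  exact Finset.sum_le_sum_of_subset_of_nonneg (Finset.subset_univ _) fun σ _ _ => hg σ

/-- **THE POLYNOMIAL INTO THE GAUSSIAN**: `(1 + x)^{Ng} · e^{−π x} ≤ K(Ng) · e^{−(π∕2) x}` for `x ≥ 0` and ANY real `Ng` (`K(Ng) = 2^{⌈Ng⌉}(1 + ⌈Ng⌉!·(2∕π)^{⌈Ng⌉})`;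
★ `K2LiuSiegelEisensteinKindWLocalExponents.one_add_pow_mul_exp_neg_le` at `H := 1`) — so the one-frame assembly needs NO ceiling on the line character's size `|σ♭|_σ`.
[cite: MoeglinWaldspurger1995, II.1.7] -/
theorem one_add_rpow_mul_exp_neg_pi_le {x : ℝ} (hx : 0 ≤ x) (Ng : ℝ) :
    (1 + x) ^ Ng * Real.exp (-(Real.pi * x)) ≤
      ((2 : ℝ) ^ ⌈Ng⌉₊ * (1 + ((⌈Ng⌉₊).factorial : ℝ) * (2 / Real.pi) ^ ⌈Ng⌉₊)) * Real.exp (-(Real.pi / 2 * x)) := by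
  have h1 : (1 + x) ^ Ng ≤ (1 + x) ^ ⌈Ng⌉₊ := by
    calc (1 + x) ^ Ng ≤ (1 + x) ^ ((⌈Ng⌉₊ : ℕ) : ℝ) := Real.rpow_le_rpow_of_exponent_le (by linarith) (Nat.le_ceil Ng)
      _ = (1 + x) ^ ⌈Ng⌉₊ := Real.rpow_natCast _ _
  have h2 := one_add_pow_mul_exp_neg_le (c := Real.pi) (c₀ := 1) (H := 1) (a' := 0) (τ := x) Real.pi_pos one_pos le_rfl le_rfl hx ⌈Ng⌉₊
  simp only [Real.one_rpow, mul_one, neg_zero, zero_mul] at h2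
  have hE : 0 ≤ Real.exp (-(Real.pi * x)) := (Real.exp_pos _).le
  calc (1 + x) ^ Ng * Real.exp (-(Real.pi * x)) ≤ (1 + x) ^ ⌈Ng⌉₊ * Real.exp (-(Real.pi * x)) := mul_le_mul_of_nonneg_right h1 hE
    _ = Real.exp (-(Real.pi * x)) * (1 + x) ^ ⌈Ng⌉₊ := mul_comm _ _
    _ ≤ _ := h2

/-- **THE PER-PLACE FACTOR OF THE BLOCK LETTER `hBL₁`.**  At one archimedean place: `G = ĝ^{φ}` a 2×2 complex matrix with `G·Ginv = 1`, entries of `G, Ginv` below `Vb ≥ 1` and a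
UNIT entry `‖G 1 i‖ = 1` in the corner row (the NORMALISED row section, ★ p863259); `A·Ainv = 1` the Iwasawa Levi block of `h` with entries below `R` (★ G7-B: `R = c_B‖h‖`);
`Y := G·A` the corner block of the translate, `ρ := Σ_k ‖Y 1 k‖²` the square of the line's Levi coordinate; payer exponents `|e₁| ≤ κ₁`, `|e₂| ≤ κ₂`; `m ≥ 0` (read `|σ♭|_σ`),
any real `Ng`; and one ceiling `a₁ ≥ 8·Vb²·R²`.  THEN
`ρ^{e₁} · ‖det Y‖^{e₂} · ((1 + mρ)^{Ng} · e^{−π mρ}) ≤ a₁^{κ₁} · a₁^{κ₂} · (K(Ng) · e^{−(π∕2) mρ})`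
— two-sided `ρ` (floor ★ (dec-3b-ii) `inv_sum_sq_vecMul_le` by the unit entry, ceiling by the entry bounds), two-sided `‖det Y‖` (★ (dec-3c) `norm_det_rpow_le` on `Y·(Ainv·Ginv) = 1`),
and the polynomial into the Gaussian (`one_add_rpow_mul_exp_neg_pi_le`).  [cite: BorelJacquet1979, §1.2, §4.1] [cite: MoeglinWaldspurger1995, II.1.5, II.1.7] -/
theorem perPlace_le {G Ginv A Ainv : Matrix (Fin 2) (Fin 2) ℂ} (hG : G * Ginv = 1) (hA : A * Ainv = 1)
    {Vb R a₁ : ℝ} (hVb : 1 ≤ Vb) (hGe : ∀ a b, ‖G a b‖ ≤ Vb) (hGie : ∀ a b, ‖Ginv a b‖ ≤ Vb)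
    (hAe : ∀ a b, ‖A a b‖ ≤ R) (hAie : ∀ a b, ‖Ainv a b‖ ≤ R) {i : Fin 2} (hunit : ‖G 1 i‖ = 1)
    (ha₁ : 8 * Vb ^ 2 * R ^ 2 ≤ a₁)
    {e₁ e₂ κ₁ κ₂ : ℝ} (he₁ : |e₁| ≤ κ₁) (he₂ : |e₂| ≤ κ₂) {m : ℝ} (hm : 0 ≤ m) (Ng : ℝ) :
    (∑ k, ‖(G * A) 1 k‖ ^ 2) ^ e₁ * ‖(G * A).det‖ ^ e₂ *
        ((1 + m * ∑ k, ‖(G * A) 1 k‖ ^ 2) ^ Ng * Real.exp (-(Real.pi * (m * ∑ k, ‖(G * A) 1 k‖ ^ 2)))) ≤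
      a₁ ^ κ₁ * a₁ ^ κ₂ * (((2 : ℝ) ^ ⌈Ng⌉₊ * (1 + ((⌈Ng⌉₊).factorial : ℝ) * (2 / Real.pi) ^ ⌈Ng⌉₊)) *
        Real.exp (-(Real.pi / 2 * (m * ∑ k, ‖(G * A) 1 k‖ ^ 2)))) := by
  have hR0 : 0 ≤ R := (norm_nonneg _).trans (hAe 0 0)
  have hVb0 : 0 ≤ Vb := zero_le_one.trans hVb
  -- the corner row `ρ` and its two-sided bound
  have hρeq : ∑ k, ‖(G * A) 1 k‖ ^ 2 = ∑ k, ‖((fun l => G 1 l) ᵥ* A) k‖ ^ 2 := corner_row_sq_eq G A 1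
  have hunit' : 1 ≤ ‖(fun l => G 1 l) i‖ := by simp only [hunit, le_refl]
  have hρpos : 0 < ∑ k, ‖(G * A) 1 k‖ ^ 2 := by rw [hρeq]; exact sum_sq_vecMul_pos _ hA hAie hunit'
  have hρlo : (∑ k, ‖(G * A) 1 k‖ ^ 2)⁻¹ ≤ a₁ := by
    rw [hρeq]
    calc (∑ k, ‖((fun l => G 1 l) ᵥ* A) k‖ ^ 2)⁻¹ ≤ (2 : ℕ) * R ^ 2 := inv_sum_sq_vecMul_le _ hA hAie hunit'
      _ ≤ a₁ := by
          have hV1 : 1 ≤ Vb ^ 2 := one_le_pow₀ hVb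
          have h1 : R ^ 2 ≤ Vb ^ 2 * R ^ 2 := by nlinarith [sq_nonneg R]
          push_cast
          nlinarith [sq_nonneg R]
  have hYe : ∀ a b, ‖(G * A) a b‖ ≤ 2 * (Vb * R) := fun a b => by
    have := norm_mul_apply_le hVb0 hGe hAe a b
    simpa [Fintype.card_fin] using this
  have hρup : ∑ k, ‖(G * A) 1 k‖ ^ 2 ≤ a₁ := by
    calc ∑ k, ‖(G * A) 1 k‖ ^ 2 ≤ ∑ _k : Fin 2, (2 * (Vb * R)) ^ 2 :=
          Finset.sum_le_sum fun k _ => pow_le_pow_left₀ (norm_nonneg _) (hYe 1 k) 2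
      _ = 8 * Vb ^ 2 * R ^ 2 := by simp only [Finset.sum_const, Finset.card_univ, Fintype.card_fin, nsmul_eq_mul]; push_cast; ring
      _ ≤ a₁ := ha₁
  have hρ := rpow_le_rpow_of_abs_le hρpos hρup hρlo he₁
  -- the determinant, two-sided: `Y · (Ainv · Ginv) = 1`, entries of both below `2 Vb R`
  have hYinv : (G * A) * (Ainv * Ginv) = 1 := by
    calc G * A * (Ainv * Ginv) = G * (A * Ainv) * Ginv := by simp only [Matrix.mul_assoc]
      _ = 1 := by rw [hA, Matrix.mul_one, hG]
  have hYie : ∀ a b, ‖(Ainv * Ginv) a b‖ ≤ 2 * (Vb * R) := fun a b => by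
    have := norm_mul_apply_le hR0 hAie hGie a b
    have h' : (Fintype.card (Fin 2) : ℝ) * (R * Vb) = 2 * (Vb * R) := by simp [Fintype.card_fin]; ring
    linarith
  have hdet0 := norm_det_rpow_le hYinv hYe hYie e₂
  have hdet : ‖(G * A).det‖ ^ e₂ ≤ a₁ ^ κ₂ := by
    have hb : ((Fintype.card (Fin 2)).factorial : ℝ) * (2 * (Vb * R)) ^ Fintype.card (Fin 2) = 8 * Vb ^ 2 * R ^ 2 := by
      simp [Fintype.card_fin]; ring
    rw [hb] at hdet0
    have ha₁1 : 1 ≤ a₁ := (one_le_of_le_of_inv_le hρpos hρup hρlo)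
    calc ‖(G * A).det‖ ^ e₂ ≤ (8 * Vb ^ 2 * R ^ 2) ^ |e₂| := hdet0
      _ ≤ a₁ ^ |e₂| := Real.rpow_le_rpow (by positivity) ha₁ (abs_nonneg _)
      _ ≤ a₁ ^ κ₂ := Real.rpow_le_rpow_of_exponent_le ha₁1 he₂
  -- the polynomial into the Gaussian
  have hmx : 0 ≤ m * ∑ k, ‖(G * A) 1 k‖ ^ 2 := mul_nonneg hm hρpos.le
  have hpoly := one_add_rpow_mul_exp_neg_pi_le hmx Ng
  -- assemble
  have h0d : 0 ≤ ‖(G * A).det‖ ^ e₂ := Real.rpow_nonneg (norm_nonneg _) _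
  have h0p : 0 ≤ (1 + m * ∑ k, ‖(G * A) 1 k‖ ^ 2) ^ Ng * Real.exp (-(Real.pi * (m * ∑ k, ‖(G * A) 1 k‖ ^ 2))) :=
    mul_nonneg (Real.rpow_nonneg (by linarith) _) (Real.exp_pos _).le
  have ha₁0 : 0 ≤ a₁ := hρpos.le |> fun _ => le_trans (by positivity) ha₁
  exact mul_le_mul (mul_le_mul hρ hdet h0d (Real.rpow_nonneg ha₁0 _)) hpoly h0p
    (mul_nonneg (Real.rpow_nonneg ha₁0 _) (Real.rpow_nonneg ha₁0 _))

end Summit.HodgeConjecture.HodgeConjecture.Cruxes.HLiu418.K2LiuKindOneLineDecayOneFramePrelims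

end
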